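import Summits.AnomalousDissipation.AnomalousDissipation.Theses.SteadyWeakLimit
import Literature.Analysis.FunctionSpaces.TorusFluidGlueProofs

/-!
# Route SteadyWeakLimit — the support `InjectionWeaklyContinuous`

Proof of the route declaration
`Summit.AnomalousDissipation.AnomalousDissipation.Theses.SteadyWeakLimit.InjectionWeaklyContinuous`
(item stmt-AnomalousDissipation-1307): along steady classical Navier–Stokes states `u j` on `T³`
with viscosities `ν j`, smooth steady forces `fs j → f` in `L²`, energies `∫ ‖u j‖² ≤ E` and
`u j ⇀ v` weakly (pairings with smooth fields), the dissipation `ν j ‖∇u j‖₂²` converges to the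
injection `∫ ⟪f, v⟫`.

Mathematics (Temam 1979, Ch. II (1.21)–(1.22); Constantin–Tarfulea–Vicol 2013, p. 6;
Doering–Foias 2002, §2):
* steady energy identity `ν j ‖∇u j‖₂² = ∫ ⟪fs j, u j⟫`: the kinetic energy of a constant path
  is constant, and its one-sided derivative within `univ` at `t = 0` is
  `-ν j ‖∇u j‖₂² + ∫ ⟪fs j, u j⟫` by the discharged energy balance
  `Torus.IsClassicalNSSolutionOn.energy_balance_holds`; uniqueness of derivatives;
* `∫ ⟪fs j, u j⟫ = ∫ ⟪fs j - f, u j⟫ + ∫ ⟪f, u j⟫`, where the first term is at most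
  `‖fs j - f‖_{L²} ‖u j‖_{L²} ≤ ‖fs j - f‖_{L²} √E → 0` (Cauchy–Schwarz in `L²(T³)`), and the
  second tends to `∫ ⟪f, v⟫` by the weak-convergence hypothesis tested with `w = f`.

No new definitions; imports only the route file and the discharged energy balance.
-/

namespace Summit.AnomalousDissipation.AnomalousDissipation.Theorems

-- the mandated namespace `Summit.<Summit>.<Problem>.Theorems` repeats `AnomalousDissipation` (single-problem summit)
set_option linter.dupNamespace false

open MeasureTheory Filter Topology
open scoped InnerProductSpace ENNReal
open Literature.Analysis.FunctionSpaces Literature.Analysis.FunctionSpaces.Torus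
open Summit.AnomalousDissipation.AnomalousDissipation.Theses.SteadyWeakLimit

/-- **Cauchy–Schwarz for `L²` pairings**: `|∫ ⟪f, g⟫| ≤ ‖f‖_{L²} ‖g‖_{L²}` for `f, g ∈ L²(μ)`
with values in a real inner product space (the pairing is the inner product of `L²(μ)`,
`MeasureTheory.L2.inner_def`). [folklore] -/
theorem steadyWeakLimit_abs_integral_inner_le {α : Type*} [MeasurableSpace α] {μ : Measure α}
    {F : Type*} [NormedAddCommGroup F] [InnerProductSpace ℝ F]
    {f g : α → F} (hf : MemLp f 2 μ) (hg : MemLp g 2 μ) :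
    |∫ x, ⟪f x, g x⟫_ℝ ∂μ| ≤ (eLpNorm f 2 μ).toReal * (eLpNorm g 2 μ).toReal := by
  have e : ∫ x, ⟪f x, g x⟫_ℝ ∂μ = ⟪hf.toLp f, hg.toLp g⟫_ℝ := by
    rw [L2.inner_def]
    refine integral_congr_ae ?_
    filter_upwards [hf.coeFn_toLp, hg.coeFn_toLp] with x hfx hgx
    rw [hfx, hgx]
  rw [e, ← Lp.norm_toLp f hf, ← Lp.norm_toLp g hg]
  exact abs_real_inner_le_norm _ _

/-- `‖w‖_{L²} ≤ √E` whenever `w ∈ L²` and `∫ ‖w‖² ≤ E` (`∫ ‖w‖² = ‖w‖_{L²}²`). [folklore] -/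
theorem steadyWeakLimit_toReal_eLpNorm_le_sqrt {α : Type*} [MeasurableSpace α] {μ : Measure α}
    {F : Type*} [NormedAddCommGroup F] [InnerProductSpace ℝ F]
    {w : α → F} (hw : MemLp w 2 μ) {E : ℝ} (hE : ∫ x, ‖w x‖ ^ 2 ∂μ ≤ E) :
    (eLpNorm w 2 μ).toReal ≤ Real.sqrt E := by
  have hsq : ∫ x, ‖w x‖ ^ 2 ∂μ = ((eLpNorm w 2 μ).toReal) ^ 2 := by
    rw [← Lp.norm_toLp w hw, ← real_inner_self_eq_norm_sq (hw.toLp w), L2.inner_def]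
    refine integral_congr_ae ?_
    filter_upwards [hw.coeFn_toLp] with x hx
    rw [hx, real_inner_self_eq_norm_sq]
  rw [hsq] at hE
  calc (eLpNorm w 2 μ).toReal = Real.sqrt (((eLpNorm w 2 μ).toReal) ^ 2) :=
        (Real.sqrt_sq ENNReal.toReal_nonneg).symm
    _ ≤ Real.sqrt E := Real.sqrt_le_sqrt hE

/-- **Energy identity of steady classical states** on `T³`: if `(w, q)` is a classical solution of
`NS_ν(g)` on the time set `univ` which is constant in time, then `ν ‖∇w‖₂² = ∫ ⟪g, w⟫`
(the kinetic energy of the constant path has derivative `0 = -ν ‖∇w‖₂² + ∫ ⟪g, w⟫`,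
`Torus.IsClassicalNSSolutionOn.energy_balance_holds`; Temam 1979, Ch. II (1.21)–(1.22);
Constantin–Tarfulea–Vicol 2013, §2). [folklore] -/
theorem steadyWeakLimit_steady_energy_identity {ν : ℝ}
    {g w : UnitAddTorus (Fin 3) → EuclideanSpace ℝ (Fin 3)} {q : UnitAddTorus (Fin 3) → ℝ}
    (h : IsClassicalNSSolutionOn Set.univ ν (fun _ => g) (fun _ => w) (fun _ => q)) :
    ν * gradNormSq w = ∫ x, ⟪g x, w x⟫_ℝ := by
  have h1 : HasDerivWithinAt (fun s : ℝ => kineticEnergy ((fun _ : ℝ => w) s))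
      (-ν * gradNormSq w + ∫ x, ⟪g x, w x⟫_ℝ) Set.univ 0 :=
    IsClassicalNSSolutionOn.energy_balance_holds h convex_univ (Set.mem_univ 0)
  have h2 : HasDerivAt (fun _ : ℝ => kineticEnergy w) (-ν * gradNormSq w + ∫ x, ⟪g x, w x⟫_ℝ) 0 :=
    h1.hasDerivAt Filter.univ_mem
  have h3 : HasDerivAt (fun _ : ℝ => kineticEnergy w) 0 0 := hasDerivAt_const 0 _
  have h4 := h3.unique h2
  linarith

/-- **Support `InjectionWeaklyContinuous` of route SteadyWeakLimit** (item
stmt-AnomalousDissipation-1307): for a smooth force `f`, smooth steady forces `fs j → f` in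
`L²(T³)`, steady classical states `(u j, p j)` of `NS_{ν j}(fs j)` with `∫ ‖u j‖² ≤ E` converging
weakly to `v` against smooth fields, `ν j ‖∇u j‖₂² → ∫ ⟪f, v⟫`. Proof: the steady energy
identity `ν j ‖∇u j‖₂² = ∫ ⟪fs j, u j⟫`, the splitting
`∫ ⟪fs j, u j⟫ = ∫ ⟪fs j - f, u j⟫ + ∫ ⟪f, u j⟫`, Cauchy–Schwarz
`|∫ ⟪fs j - f, u j⟫| ≤ ‖fs j - f‖_{L²} √E → 0`, and the weak-convergence hypothesis at `w = f`. -/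
theorem injectionWeaklyContinuous_proof :
    Summit.AnomalousDissipation.AnomalousDissipation.Theses.SteadyWeakLimit.InjectionWeaklyContinuous := by
  unfold InjectionWeaklyContinuous
  intro f v ν fs u p E hf hfs hconv hNS hE hweak
  -- the states are smooth (time slices of jointly smooth space–time fields)
  have hu : ∀ j, IsSmooth (u j) := fun j =>
    (hNS j).smooth_velocity.isSmooth_slice (Set.mem_univ (0 : ℝ))
  -- steady energy identity
  have hid : ∀ j, ν j * gradNormSq (u j) = ∫ x, ⟪fs j x, u j x⟫_ℝ := fun j =>
    steadyWeakLimit_steady_energy_identity (hNS j)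
  -- splitting of the pairing
  have hsplit : ∀ j, ∫ x, ⟪fs j x, u j x⟫_ℝ =
      (∫ x, ⟪(fs j - f) x, u j x⟫_ℝ) + ∫ x, ⟪f x, u j x⟫_ℝ := by
    intro j
    rw [← integral_add (((hfs j).sub hf).inner (hu j)).integrable (hf.inner (hu j)).integrable]
    refine integral_congr_ae (ae_of_all _ fun x => ?_)
    show ⟪fs j x, u j x⟫_ℝ = ⟪(fs j - f) x, u j x⟫_ℝ + ⟪f x, u j x⟫_ℝ
    rw [Pi.sub_apply, inner_sub_left]
    ring
  -- `‖fs j - f‖_{L²} → 0` as real numbers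
  have hR : Tendsto (fun j => (eLpNorm (fs j - f) 2 volume).toReal) atTop (𝓝 0) := by
    have h0 := (ENNReal.tendsto_toReal ENNReal.zero_ne_top).comp hconv
    rwa [ENNReal.toReal_zero] at h0
  -- the first term tends to zero (Cauchy–Schwarz and the energy bound)
  have h1 : Tendsto (fun j => ∫ x, ⟪(fs j - f) x, u j x⟫_ℝ) atTop (𝓝 0) := by
    refine squeeze_zero_norm (a := fun j => (eLpNorm (fs j - f) 2 volume).toReal * Real.sqrt E)
      (fun j => ?_) ?_
    · rw [Real.norm_eq_abs]
      refine (steadyWeakLimit_abs_integral_inner_le (((hfs j).sub hf).memLp 2)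
        ((hu j).memLp 2)).trans ?_
      exact mul_le_mul_of_nonneg_left
        (steadyWeakLimit_toReal_eLpNorm_le_sqrt ((hu j).memLp 2) (hE j)) ENNReal.toReal_nonneg
    · have h := hR.mul_const (Real.sqrt E)
      rwa [zero_mul] at h
  -- the second term is the weak-convergence hypothesis tested with `w = f`
  have h2 := hweak f hf
  have h3 := h1.add h2
  rw [zero_add] at h3
  refine h3.congr fun j => ?_
  rw [hid j, hsplit j]

end Summit.AnomalousDissipation.AnomalousDissipation.Theorems
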